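import Summits.QuantumFields.BalabanUV.Beta.RowD1JointEnd
import Summits.QuantumFields.BalabanUV.Beta.MixedLetterUnpacking
import Summits.QuantumFields.BalabanUV.Beta.BorderLetterPacking
import Summits.QuantumFields.BalabanUV.Beta.WardLettersUnpacking
import Summits.QuantumFields.BalabanUV.Beta.MixedWardPacking

/-!
# `BalabanUV.Beta.RowD1FromBondLaws` — binder row D1: **hR, and hW ∧ hR, FOR THE ROW LITERAL OF RECORD `JsRowD1` FROM BOND-LEVEL IDENTITIES
# ON an1's AVERAGING TABLES** (β sub-cell, D1 formalisation swarm, leaf-05 gen 7; capstone «RX» of the adapters MX2∕MX4 (mixed reflection),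
# BX2 (border reflection), WX4 (Ward letters) over the row-D1 owner an2-g21's K-Q `RowD1JointEnd`)

HONEST FRAMING (cell charter, verbatim): «discharging BetaPertH makes Balaban's UV stability UNCONDITIONAL — a real
constructive-QFT result; it is NOT the continuum limit and NOT the Clay problem.»
HONEST DEPENDENCY: continuum YM on T⁴ ⇐ BetaPertH ∧ nine spine estimates (0/9 proved); BetaPertH ⇐ (D1) ∧ (D4) ∧ CAP+tail;
G-an2-4 gates asym, D1 and NE2/3/4.
DERIVED cell leaf (pure wiring BY NAME: K-Q `axisReflectionCovariant_flipK_TbalOf_JsRowD1_of_letters` ∕ `symmetries_JsRowD1_of_letters` (an2-g21),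
MX4 `tableLaw_iff_bondLaw`, BX2 `borderInv_of_bondLaw`, WX4 `hBord0_of_bondWard` ∕ `hBord0''_of_bondWard` (leaf-05), K-W1
`MixedWardPacking.mixedWardBinders_of_bondLaw` (an2-g21)).
CONDITIONAL: the four bond-level identities below are HYPOTHESES (mixed ∕ border REFLECTION laws: an1-g28 l.11301 ∕ l.11788, toy-certified by
an1-g28 and independently by beta-num-g38; border ∕ mixed WARD identities: the gauge-covariance of the rooted averaging, NOT yet certified) —
NOT theorems of the tree; they are the targets of the AVG-LETTERS chain.  No statement of Bałaban's papers, no `[cite:]`, no definition, no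
`Prop` fact.  The weights are DISPLAYED, not ruled: `cΛ·Lc⁴ = 2` (Λ-lock), `cB = −Lc¹²∕4` (lockB).  This gives hW ∧ hR of the ONE literal
CONDITIONALLY (2 of the 4 binders hW, hR, D1Tel, D1Rep, modulo the displayed identities); NOT D1, NOT BetaPertH, NOT continuum, NOT Clay.

* **`axisReflectionCovariant_flipK_TbalOf_JsRowD1_of_bondLaws`**: hR ⟸ the two reflection bond laws (`hMb`, `hBb`).
* **`symmetries_JsRowD1_of_bondLaws`**: hW ∧ hR ⟸ the two reflection bond laws ∧ the two Ward bond identities (`hWb` border — WX4; `hWM` mixed,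
  f↔f′-symmetrised — the row owner's K-W1 `MixedWardPacking.mixedWardBinders_of_bondLaw`, whose residual `RWof` has its class PROVED).
* **`symmetries_JsRowD1Pin_of_bondLaws`**, **`d1Drift_JsRowD1Pin_of_bondLaws_D1Tel_D1Rep`**: the same for K-Q v1.1's PINNED literal
  `JsRowD1Pin hLc N` (`cΛ := 2∕Lc⁴`, `cB := −Lc¹²∕4`, no lock hypothesis), and the row's ONE kernel statement in bond currency:
  `D1Drift Lc (JsRowD1Pin hLc N) Nc μ ν ⟸ four bond identities ∧ D1Tel ∧ D1Rep` (+ the route theorem's own binders, verbatim).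
Provenance: β sub-cell, D1 formalisation swarm, unit b2b-balaban-beta-d1-formalise-leaf-05 gen 7, 2026-08-20 (v1); no existing file touched.
-/

open Finset
open scoped BigOperators
open Literature.MathematicalPhysics.QuantumFieldTheory
open Literature.MathematicalPhysics.QuantumFieldTheory.Balaban1983to89
open Literature.MathematicalPhysics.QuantumFieldTheory.Balaban1983to89.Beta
open ExpKernelCalculus (MKer VertexFamily)
open AffineAveraging (box toSite)
open AveragingContours (blk off)
open AveragingContoursRooted (ctrOff)
open AveragingHessianKernelsRooted (vhKerAt linKerAt hessKerAt)
open AveragingMixedJetTables (vh2KerAt mixKerAt)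
open PolarizationSign (reflSign WardTransversal AxisReflectionCovariant)
open ResolventReflection (bref)
open OneStepResolventKernel (Fib JetData)
open OneStepKernelFamily (TbalOf flipK D1Tel D1Rep D1Drift d1Drift_of_D1Tel_D1Rep)
open Literature.MathematicalPhysics.QuantumFieldTheory.Balaban1983to89.Beta.VectorTailsLoc (fam kfam)
open Literature.MathematicalPhysics.QuantumFieldTheory.Balaban1983to89.Beta.VectorLegVolumeAdapter (MvE)
open B6BondElimination (unitVec)
open BalabanStepJetsSucc (wVH)
open BalabanStepW2 (wM1 wM2)
open Summit.QuantumFields.BalabanUV.Beta.TameKernelCalculus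
open Summit.QuantumFields.BalabanUV.Beta.BorderedHessian (stepScale sgnK)
open Summit.QuantumFields.BalabanUV.Beta.RowD1JointEnd (JsRowD1 JsRowD1Pin lockΛ_pin axisReflectionCovariant_flipK_TbalOf_JsRowD1_of_letters
  symmetries_JsRowD1_of_letters)
open Summit.QuantumFields.BalabanUV.Beta.MixedLetterUnpacking (tableLaw_iff_bondLaw)
open Summit.QuantumFields.BalabanUV.Beta.BorderLetterPacking (borderInv_of_bondLaw)
open Summit.QuantumFields.BalabanUV.Beta.WardLettersUnpacking (hBord0_of_bondWard hBord0''_of_bondWard)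
open Summit.QuantumFields.BalabanUV.Beta.MixedWardPacking (RWof mixedWardBinders_of_bondLaw)

namespace Summit.QuantumFields.BalabanUV.Beta.RowD1FromBondLaws

noncomputable section

variable {Lc : ℕ} [NeZero Lc]

open Classical in
/-- [folklore] **hR FOR THE ROW LITERAL `JsRowD1 hLc N cΛ (−Lc¹²∕4)` FROM THE TWO REFLECTION BOND LAWS** (mixed `hMb`, border `hBb`; both
HYPOTHESES), at the Λ-lock `cΛ·Lc⁴ = 2` and the lockB weight `cB = −Lc¹²∕4`. -/
theorem axisReflectionCovariant_flipK_TbalOf_JsRowD1_of_bondLaws (hLc : Odd Lc) {N : ℕ} (hN : 2 ≤ N) {cΛ : ℝ}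
    (hΛ : cΛ * (Lc : ℝ) ^ 4 = 2) (γ : ℕ → ℝ)
    (hγ : ∀ j, γ j = -((Lc : ℝ) ^ 8 / 2) * wVH 3 Lc j / (stepScale 3 Lc j * (Lc : ℝ) ^ 4))
    (hMb : ∀ (α κ : Fin 4) (u : Fin 4 → ℤ) (ρ' : Fin 4) (w : Fin 4 → ℤ) (β : Fin 4) (x : Fin 4 → ℤ) (β' : Fin 4) (z : Fin 4 → ℤ),
      mixKerAt (toSite (ctrOff 4 Lc)) Lc ρ' (bref α ρ' w) (κ, bref α κ u) (β, x) (β', z)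
        = reflSign α κ * reflSign α ρ' * (reflSign α β * reflSign α β' *
            (mixKerAt (toSite (ctrOff 4 Lc)) Lc ρ' w (κ, u) (β, bref α β x) (β', bref α β' z)
              + 2 * (if bref α β x = u ∧ β = κ ∧ κ = α then -1 else 0)
                  * hessKerAt (toSite (ctrOff 4 Lc)) Lc ρ' w (β, bref α β x) (β', bref α β' z)
              + 2 * (if ρ' = α then linKerAt (toSite (ctrOff 4 Lc)) Lc ρ' w (κ, u) else 0)
                  * hessKerAt (toSite (ctrOff 4 Lc)) Lc ρ' w (β, bref α β x) (β', bref α β' z))))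
    (hBb : ∀ (α m : Fin 4) (y : Fin 4 → ℤ) (β : Fin 4) (x : Fin 4 → ℤ) (κ : Fin 4) (u : Fin 4 → ℤ) (κ' : Fin 4) (u' : Fin 4 → ℤ),
      reflSign α β * reflSign α κ * reflSign α κ' * reflSign α m *
          (vh2KerAt (toSite (ctrOff 4 Lc)) Lc m (bref α m y) (β, bref α β x) (κ, bref α κ u) (κ', bref α κ' u')
            + vh2KerAt (toSite (ctrOff 4 Lc)) Lc m (bref α m y) (β, bref α β x) (κ', bref α κ' u') (κ, bref α κ u))
        = (vh2KerAt (toSite (ctrOff 4 Lc)) Lc m y (β, x) (κ, u) (κ', u') + vh2KerAt (toSite (ctrOff 4 Lc)) Lc m y (β, x) (κ', u') (κ, u))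
          + 2 * (vhKerAt (toSite (ctrOff 4 Lc)) Lc m y (β, x) (κ', u')
                  * ((if m = α then linKerAt (toSite (ctrOff 4 Lc)) Lc m y (κ, u) else 0) - (if x = u ∧ β = κ ∧ κ = α then 1 else 0))
                + vhKerAt (toSite (ctrOff 4 Lc)) Lc m y (β, x) (κ, u)
                  * ((if m = α then linKerAt (toSite (ctrOff 4 Lc)) Lc m y (κ', u') else 0) - (if x = u' ∧ β = κ' ∧ κ' = α then 1 else 0))
                + linKerAt (toSite (ctrOff 4 Lc)) Lc m y (β, x)
                  * ((if m = α then linKerAt (toSite (ctrOff 4 Lc)) Lc m y (κ, u) else 0) - (if x = u ∧ β = κ ∧ κ = α then 1 else 0))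
                  * ((if m = α then linKerAt (toSite (ctrOff 4 Lc)) Lc m y (κ', u') else 0) - (if x = u' ∧ β = κ' ∧ κ' = α then 1 else 0)))) :
    ∀ j : ℕ, AxisReflectionCovariant (flipK (TbalOf Lc (JsRowD1 hLc N cΛ (-((Lc : ℝ) ^ 12 / 4))) j)) :=
  axisReflectionCovariant_flipK_TbalOf_JsRowD1_of_letters hLc hN hΛ (-((Lc : ℝ) ^ 12 / 4)) γ hγ (tableLaw_iff_bondLaw.2 hMb)
    (borderInv_of_bondLaw hLc cΛ γ hγ hBb)

open Classical in
/-- [folklore] **hW ∧ hR FOR THE ROW LITERAL `JsRowD1 hLc N cΛ (−Lc¹²∕4)` FROM FOUR BOND-LEVEL IDENTITIES ON an1's TABLES** — the two reflection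
laws (`hMb`, `hBb`) and the two Ward identities (`hWb` border at `cB = −Lc¹²∕4`, `hWM` mixed, f↔f′-symmetrised) — ALL HYPOTHESES; K-Q's
`symmetries_JsRowD1_of_letters` with every letter supplied by the adapters (the mixed residual is the owner's `RWof Lc cΛ`, class and parity
from `mixedWardBinders_of_bondLaw`). -/
theorem symmetries_JsRowD1_of_bondLaws (hLc : Odd Lc) {N : ℕ} (hN : 2 ≤ N) {cΛ : ℝ}
    (hΛ : cΛ * (Lc : ℝ) ^ 4 = 2) (γ : ℕ → ℝ)
    (hγ : ∀ j, γ j = -((Lc : ℝ) ^ 8 / 2) * wVH 3 Lc j / (stepScale 3 Lc j * (Lc : ℝ) ^ 4))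
    (hMb : ∀ (α κ : Fin 4) (u : Fin 4 → ℤ) (ρ' : Fin 4) (w : Fin 4 → ℤ) (β : Fin 4) (x : Fin 4 → ℤ) (β' : Fin 4) (z : Fin 4 → ℤ),
      mixKerAt (toSite (ctrOff 4 Lc)) Lc ρ' (bref α ρ' w) (κ, bref α κ u) (β, x) (β', z)
        = reflSign α κ * reflSign α ρ' * (reflSign α β * reflSign α β' *
            (mixKerAt (toSite (ctrOff 4 Lc)) Lc ρ' w (κ, u) (β, bref α β x) (β', bref α β' z)
              + 2 * (if bref α β x = u ∧ β = κ ∧ κ = α then -1 else 0)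
                  * hessKerAt (toSite (ctrOff 4 Lc)) Lc ρ' w (β, bref α β x) (β', bref α β' z)
              + 2 * (if ρ' = α then linKerAt (toSite (ctrOff 4 Lc)) Lc ρ' w (κ, u) else 0)
                  * hessKerAt (toSite (ctrOff 4 Lc)) Lc ρ' w (β, bref α β x) (β', bref α β' z))))
    (hBb : ∀ (α m : Fin 4) (y : Fin 4 → ℤ) (β : Fin 4) (x : Fin 4 → ℤ) (κ : Fin 4) (u : Fin 4 → ℤ) (κ' : Fin 4) (u' : Fin 4 → ℤ),
      reflSign α β * reflSign α κ * reflSign α κ' * reflSign α m *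
          (vh2KerAt (toSite (ctrOff 4 Lc)) Lc m (bref α m y) (β, bref α β x) (κ, bref α κ u) (κ', bref α κ' u')
            + vh2KerAt (toSite (ctrOff 4 Lc)) Lc m (bref α m y) (β, bref α β x) (κ', bref α κ' u') (κ, bref α κ u))
        = (vh2KerAt (toSite (ctrOff 4 Lc)) Lc m y (β, x) (κ, u) (κ', u') + vh2KerAt (toSite (ctrOff 4 Lc)) Lc m y (β, x) (κ', u') (κ, u))
          + 2 * (vhKerAt (toSite (ctrOff 4 Lc)) Lc m y (β, x) (κ', u')
                  * ((if m = α then linKerAt (toSite (ctrOff 4 Lc)) Lc m y (κ, u) else 0) - (if x = u ∧ β = κ ∧ κ = α then 1 else 0))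
                + vhKerAt (toSite (ctrOff 4 Lc)) Lc m y (β, x) (κ, u)
                  * ((if m = α then linKerAt (toSite (ctrOff 4 Lc)) Lc m y (κ', u') else 0) - (if x = u' ∧ β = κ' ∧ κ' = α then 1 else 0))
                + linKerAt (toSite (ctrOff 4 Lc)) Lc m y (β, x)
                  * ((if m = α then linKerAt (toSite (ctrOff 4 Lc)) Lc m y (κ, u) else 0) - (if x = u ∧ β = κ ∧ κ = α then 1 else 0))
                  * ((if m = α then linKerAt (toSite (ctrOff 4 Lc)) Lc m y (κ', u') else 0) - (if x = u' ∧ β = κ' ∧ κ' = α then 1 else 0))))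
    (hWb : ∀ (Y : Fin 4 → ℤ) (κ' : Fin 4) (u' x z : Fin 4 → ℤ) (β m : Fin 4), off Lc z = 0 →
      (stepScale 3 Lc 0 * (Lc : ℝ) ^ (3 + 1))⁻¹ *
          ∑ v ∈ box (3 + 1) Lc, ∑ κ : Fin (3 + 1),
            ((-((Lc : ℝ) ^ 12 / 4)) * ((1 / 2 : ℝ) * (vh2KerAt (toSite (ctrOff 4 Lc)) Lc m (blk Lc z) (β, x) (κ, (Lc : ℤ) • Y + toSite v - unitVec κ) (κ', u')
                + vh2KerAt (toSite (ctrOff 4 Lc)) Lc m (blk Lc z) (β, x) (κ', u') (κ, (Lc : ℤ) • Y + toSite v - unitVec κ)))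
              - (-((Lc : ℝ) ^ 12 / 4)) * ((1 / 2 : ℝ) * (vh2KerAt (toSite (ctrOff 4 Lc)) Lc m (blk Lc z) (β, x) (κ, (Lc : ℤ) • Y + toSite v) (κ', u')
                + vh2KerAt (toSite (ctrOff 4 Lc)) Lc m (blk Lc z) (β, x) (κ', u') (κ, (Lc : ℤ) • Y + toSite v)))) =
        (-((Lc : ℝ) ^ (3 + 1) * (1 / 2) * (Lc : ℝ) ^ (3 + 1))) * vhKerAt (toSite (ctrOff 4 Lc)) Lc m (blk Lc z) (β, x) (κ', u')
            * ((1 / 2 : ℝ) * ∑ v ∈ box (3 + 1) Lc, (if z + toSite (ctrOff 4 Lc) = (Lc : ℤ) • Y + toSite v then (1 : ℝ) else 0))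
          - ((1 / 2 : ℝ) * ∑ v ∈ box (3 + 1) Lc, (if x = (Lc : ℤ) • Y + toSite v then (1 : ℝ) else 0))
            * ((-((Lc : ℝ) ^ (3 + 1) * (1 / 2) * (Lc : ℝ) ^ (3 + 1))) * vhKerAt (toSite (ctrOff 4 Lc)) Lc m (blk Lc z) (β, x) (κ', u')))
    (hWM : ∀ (y : Fin (3 + 1) → ℤ) (ρ' : Fin (3 + 1)) (w : Fin (3 + 1) → ℤ) (β : Fin (3 + 1)) (x : Fin (3 + 1) → ℤ) (β' : Fin (3 + 1))
      (x' : Fin (3 + 1) → ℤ),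
      ((Lc : ℝ) ^ (3 + 1))⁻¹ * (∑ v ∈ box (3 + 1) Lc, ∑ κ : Fin (3 + 1),
          ((mixKerAt (toSite (ctrOff 4 Lc)) Lc ρ' w (κ, (Lc : ℤ) • y + toSite v - unitVec κ) (β, x) (β', x')
              - mixKerAt (toSite (ctrOff 4 Lc)) Lc ρ' w (κ, (Lc : ℤ) • y + toSite v) (β, x) (β', x'))
            + (mixKerAt (toSite (ctrOff 4 Lc)) Lc ρ' w (κ, (Lc : ℤ) • y + toSite v - unitVec κ) (β', x') (β, x)
              - mixKerAt (toSite (ctrOff 4 Lc)) Lc ρ' w (κ, (Lc : ℤ) • y + toSite v) (β', x') (β, x)))) =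
        2 * (cΛ * hessKerAt (toSite (ctrOff 4 Lc)) Lc ρ' w (β, x) (β', x') *
          ((1 / 2 : ℝ) * (∑ v ∈ box (3 + 1) Lc, (if x' = (Lc : ℤ) • y + toSite v then (1 : ℝ) else 0))
            - (1 / 2 : ℝ) * (∑ v ∈ box (3 + 1) Lc, (if x = (Lc : ℤ) • y + toSite v then (1 : ℝ) else 0))))) :
    (∀ j : ℕ, WardTransversal (flipK (TbalOf Lc (JsRowD1 hLc N cΛ (-((Lc : ℝ) ^ 12 / 4))) j)))
      ∧ (∀ j : ℕ, AxisReflectionCovariant (flipK (TbalOf Lc (JsRowD1 hLc N cΛ (-((Lc : ℝ) ^ 12 / 4))) j))) := by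
  obtain ⟨hcls, hpar, hM₂0⟩ := mixedWardBinders_of_bondLaw (Lc := Lc) hLc.pos cΛ hWM
  exact symmetries_JsRowD1_of_letters hLc hN hΛ (-((Lc : ℝ) ^ 12 / 4)) γ hγ (tableLaw_iff_bondLaw.2 hMb)
    (borderInv_of_bondLaw hLc cΛ γ hγ hBb) hcls hpar (hBord0_of_bondWard (-((Lc : ℝ) ^ 12 / 4)) hWb)
    (hBord0''_of_bondWard (-((Lc : ℝ) ^ 12 / 4)) hWb) hM₂0

/-! ## The pinned literal `JsRowD1Pin hLc N = JsRowD1 hLc N (2∕Lc⁴) (−Lc¹²∕4)` -/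

open Classical in
/-- [folklore] **hW ∧ hR FOR THE PINNED LITERAL `JsRowD1Pin hLc N`** (K-Q v1.1: `cΛ := 2∕Lc⁴`, `cB := −Lc¹²∕4`) from the four bond-level
identities at the pinned constants (all HYPOTHESES) — no lock hypothesis left (`lockΛ_pin`); cf. the owner's
`MixedWardPacking.symmetries_JsRowD1Pin_of_letters_bondWard` (same with hM ∕ hInv ∕ hBord0 ∕ hBord0″ as letters). -/
theorem symmetries_JsRowD1Pin_of_bondLaws (hLc : Odd Lc) {N : ℕ} (hN : 2 ≤ N) (γ : ℕ → ℝ)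
    (hγ : ∀ j, γ j = -((Lc : ℝ) ^ 8 / 2) * wVH 3 Lc j / (stepScale 3 Lc j * (Lc : ℝ) ^ 4))
    (hMb : ∀ (α κ : Fin 4) (u : Fin 4 → ℤ) (ρ' : Fin 4) (w : Fin 4 → ℤ) (β : Fin 4) (x : Fin 4 → ℤ) (β' : Fin 4) (z : Fin 4 → ℤ),
      mixKerAt (toSite (ctrOff 4 Lc)) Lc ρ' (bref α ρ' w) (κ, bref α κ u) (β, x) (β', z)
        = reflSign α κ * reflSign α ρ' * (reflSign α β * reflSign α β' *
            (mixKerAt (toSite (ctrOff 4 Lc)) Lc ρ' w (κ, u) (β, bref α β x) (β', bref α β' z)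
              + 2 * (if bref α β x = u ∧ β = κ ∧ κ = α then -1 else 0)
                  * hessKerAt (toSite (ctrOff 4 Lc)) Lc ρ' w (β, bref α β x) (β', bref α β' z)
              + 2 * (if ρ' = α then linKerAt (toSite (ctrOff 4 Lc)) Lc ρ' w (κ, u) else 0)
                  * hessKerAt (toSite (ctrOff 4 Lc)) Lc ρ' w (β, bref α β x) (β', bref α β' z))))
    (hBb : ∀ (α m : Fin 4) (y : Fin 4 → ℤ) (β : Fin 4) (x : Fin 4 → ℤ) (κ : Fin 4) (u : Fin 4 → ℤ) (κ' : Fin 4) (u' : Fin 4 → ℤ),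
      reflSign α β * reflSign α κ * reflSign α κ' * reflSign α m *
          (vh2KerAt (toSite (ctrOff 4 Lc)) Lc m (bref α m y) (β, bref α β x) (κ, bref α κ u) (κ', bref α κ' u')
            + vh2KerAt (toSite (ctrOff 4 Lc)) Lc m (bref α m y) (β, bref α β x) (κ', bref α κ' u') (κ, bref α κ u))
        = (vh2KerAt (toSite (ctrOff 4 Lc)) Lc m y (β, x) (κ, u) (κ', u') + vh2KerAt (toSite (ctrOff 4 Lc)) Lc m y (β, x) (κ', u') (κ, u))
          + 2 * (vhKerAt (toSite (ctrOff 4 Lc)) Lc m y (β, x) (κ', u')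
                  * ((if m = α then linKerAt (toSite (ctrOff 4 Lc)) Lc m y (κ, u) else 0) - (if x = u ∧ β = κ ∧ κ = α then 1 else 0))
                + vhKerAt (toSite (ctrOff 4 Lc)) Lc m y (β, x) (κ, u)
                  * ((if m = α then linKerAt (toSite (ctrOff 4 Lc)) Lc m y (κ', u') else 0) - (if x = u' ∧ β = κ' ∧ κ' = α then 1 else 0))
                + linKerAt (toSite (ctrOff 4 Lc)) Lc m y (β, x)
                  * ((if m = α then linKerAt (toSite (ctrOff 4 Lc)) Lc m y (κ, u) else 0) - (if x = u ∧ β = κ ∧ κ = α then 1 else 0))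
                  * ((if m = α then linKerAt (toSite (ctrOff 4 Lc)) Lc m y (κ', u') else 0) - (if x = u' ∧ β = κ' ∧ κ' = α then 1 else 0))))
    (hWb : ∀ (Y : Fin 4 → ℤ) (κ' : Fin 4) (u' x z : Fin 4 → ℤ) (β m : Fin 4), off Lc z = 0 →
      (stepScale 3 Lc 0 * (Lc : ℝ) ^ (3 + 1))⁻¹ *
          ∑ v ∈ box (3 + 1) Lc, ∑ κ : Fin (3 + 1),
            ((-((Lc : ℝ) ^ 12 / 4)) * ((1 / 2 : ℝ) * (vh2KerAt (toSite (ctrOff 4 Lc)) Lc m (blk Lc z) (β, x) (κ, (Lc : ℤ) • Y + toSite v - unitVec κ) (κ', u')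
                + vh2KerAt (toSite (ctrOff 4 Lc)) Lc m (blk Lc z) (β, x) (κ', u') (κ, (Lc : ℤ) • Y + toSite v - unitVec κ)))
              - (-((Lc : ℝ) ^ 12 / 4)) * ((1 / 2 : ℝ) * (vh2KerAt (toSite (ctrOff 4 Lc)) Lc m (blk Lc z) (β, x) (κ, (Lc : ℤ) • Y + toSite v) (κ', u')
                + vh2KerAt (toSite (ctrOff 4 Lc)) Lc m (blk Lc z) (β, x) (κ', u') (κ, (Lc : ℤ) • Y + toSite v)))) =
        (-((Lc : ℝ) ^ (3 + 1) * (1 / 2) * (Lc : ℝ) ^ (3 + 1))) * vhKerAt (toSite (ctrOff 4 Lc)) Lc m (blk Lc z) (β, x) (κ', u')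
            * ((1 / 2 : ℝ) * ∑ v ∈ box (3 + 1) Lc, (if z + toSite (ctrOff 4 Lc) = (Lc : ℤ) • Y + toSite v then (1 : ℝ) else 0))
          - ((1 / 2 : ℝ) * ∑ v ∈ box (3 + 1) Lc, (if x = (Lc : ℤ) • Y + toSite v then (1 : ℝ) else 0))
            * ((-((Lc : ℝ) ^ (3 + 1) * (1 / 2) * (Lc : ℝ) ^ (3 + 1))) * vhKerAt (toSite (ctrOff 4 Lc)) Lc m (blk Lc z) (β, x) (κ', u')))
    (hWM : ∀ (y : Fin (3 + 1) → ℤ) (ρ' : Fin (3 + 1)) (w : Fin (3 + 1) → ℤ) (β : Fin (3 + 1)) (x : Fin (3 + 1) → ℤ) (β' : Fin (3 + 1))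
      (x' : Fin (3 + 1) → ℤ),
      ((Lc : ℝ) ^ (3 + 1))⁻¹ * (∑ v ∈ box (3 + 1) Lc, ∑ κ : Fin (3 + 1),
          ((mixKerAt (toSite (ctrOff 4 Lc)) Lc ρ' w (κ, (Lc : ℤ) • y + toSite v - unitVec κ) (β, x) (β', x')
              - mixKerAt (toSite (ctrOff 4 Lc)) Lc ρ' w (κ, (Lc : ℤ) • y + toSite v) (β, x) (β', x'))
            + (mixKerAt (toSite (ctrOff 4 Lc)) Lc ρ' w (κ, (Lc : ℤ) • y + toSite v - unitVec κ) (β', x') (β, x)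
              - mixKerAt (toSite (ctrOff 4 Lc)) Lc ρ' w (κ, (Lc : ℤ) • y + toSite v) (β', x') (β, x)))) =
        2 * ((2 / (Lc : ℝ) ^ 4) * hessKerAt (toSite (ctrOff 4 Lc)) Lc ρ' w (β, x) (β', x') *
          ((1 / 2 : ℝ) * (∑ v ∈ box (3 + 1) Lc, (if x' = (Lc : ℤ) • y + toSite v then (1 : ℝ) else 0))
            - (1 / 2 : ℝ) * (∑ v ∈ box (3 + 1) Lc, (if x = (Lc : ℤ) • y + toSite v then (1 : ℝ) else 0))))) :
    (∀ j : ℕ, WardTransversal (flipK (TbalOf Lc (JsRowD1Pin hLc N) j)))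
      ∧ (∀ j : ℕ, AxisReflectionCovariant (flipK (TbalOf Lc (JsRowD1Pin hLc N) j))) :=
  symmetries_JsRowD1_of_bondLaws hLc hN (lockΛ_pin hLc) γ hγ hMb hBb hWb hWM

open Classical in
/-- [folklore] **BINDER ROW D1 FOR THE PINNED LITERAL IN BOND CURRENCY, ONE KERNEL STATEMENT**: `D1Drift Lc (JsRowD1Pin hLc N) Nc μ ν` ⟸ the four
displayed bond-level identities on an1's tables ∧ `D1Tel Lc (JsRowD1Pin hLc N) Jc` ∧ `D1Rep Lc Jc Nc μ ν a SL k`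
(+ the route theorem's printed B5 facts, window, `μ ≠ ν`, `Nc ≠ 0`, `2 ≤ Lc` odd, `2 ≤ N`) — K-Q's `d1Drift_JsRowD1Pin_of_letters_D1Tel_D1Rep` with
the five letters supplied by the adapters.  CONDITIONAL; `Nc` not pinned to `N` ((P6)). -/
theorem d1Drift_JsRowD1Pin_of_bondLaws_D1Tel_D1Rep (hLc : Odd Lc) (hL2 : 2 ≤ Lc) {N : ℕ} (hN : 2 ≤ N) (γ : ℕ → ℝ)
    (hγ : ∀ j, γ j = -((Lc : ℝ) ^ 8 / 2) * wVH 3 Lc j / (stepScale 3 Lc j * (Lc : ℝ) ^ 4))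
    (hMb : ∀ (α κ : Fin 4) (u : Fin 4 → ℤ) (ρ' : Fin 4) (w : Fin 4 → ℤ) (β : Fin 4) (x : Fin 4 → ℤ) (β' : Fin 4) (z : Fin 4 → ℤ),
      mixKerAt (toSite (ctrOff 4 Lc)) Lc ρ' (bref α ρ' w) (κ, bref α κ u) (β, x) (β', z)
        = reflSign α κ * reflSign α ρ' * (reflSign α β * reflSign α β' *
            (mixKerAt (toSite (ctrOff 4 Lc)) Lc ρ' w (κ, u) (β, bref α β x) (β', bref α β' z)
              + 2 * (if bref α β x = u ∧ β = κ ∧ κ = α then -1 else 0)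
                  * hessKerAt (toSite (ctrOff 4 Lc)) Lc ρ' w (β, bref α β x) (β', bref α β' z)
              + 2 * (if ρ' = α then linKerAt (toSite (ctrOff 4 Lc)) Lc ρ' w (κ, u) else 0)
                  * hessKerAt (toSite (ctrOff 4 Lc)) Lc ρ' w (β, bref α β x) (β', bref α β' z))))
    (hBb : ∀ (α m : Fin 4) (y : Fin 4 → ℤ) (β : Fin 4) (x : Fin 4 → ℤ) (κ : Fin 4) (u : Fin 4 → ℤ) (κ' : Fin 4) (u' : Fin 4 → ℤ),
      reflSign α β * reflSign α κ * reflSign α κ' * reflSign α m *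
          (vh2KerAt (toSite (ctrOff 4 Lc)) Lc m (bref α m y) (β, bref α β x) (κ, bref α κ u) (κ', bref α κ' u')
            + vh2KerAt (toSite (ctrOff 4 Lc)) Lc m (bref α m y) (β, bref α β x) (κ', bref α κ' u') (κ, bref α κ u))
        = (vh2KerAt (toSite (ctrOff 4 Lc)) Lc m y (β, x) (κ, u) (κ', u') + vh2KerAt (toSite (ctrOff 4 Lc)) Lc m y (β, x) (κ', u') (κ, u))
          + 2 * (vhKerAt (toSite (ctrOff 4 Lc)) Lc m y (β, x) (κ', u')
                  * ((if m = α then linKerAt (toSite (ctrOff 4 Lc)) Lc m y (κ, u) else 0) - (if x = u ∧ β = κ ∧ κ = α then 1 else 0))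
                + vhKerAt (toSite (ctrOff 4 Lc)) Lc m y (β, x) (κ, u)
                  * ((if m = α then linKerAt (toSite (ctrOff 4 Lc)) Lc m y (κ', u') else 0) - (if x = u' ∧ β = κ' ∧ κ' = α then 1 else 0))
                + linKerAt (toSite (ctrOff 4 Lc)) Lc m y (β, x)
                  * ((if m = α then linKerAt (toSite (ctrOff 4 Lc)) Lc m y (κ, u) else 0) - (if x = u ∧ β = κ ∧ κ = α then 1 else 0))
                  * ((if m = α then linKerAt (toSite (ctrOff 4 Lc)) Lc m y (κ', u') else 0) - (if x = u' ∧ β = κ' ∧ κ' = α then 1 else 0))))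
    (hWb : ∀ (Y : Fin 4 → ℤ) (κ' : Fin 4) (u' x z : Fin 4 → ℤ) (β m : Fin 4), off Lc z = 0 →
      (stepScale 3 Lc 0 * (Lc : ℝ) ^ (3 + 1))⁻¹ *
          ∑ v ∈ box (3 + 1) Lc, ∑ κ : Fin (3 + 1),
            ((-((Lc : ℝ) ^ 12 / 4)) * ((1 / 2 : ℝ) * (vh2KerAt (toSite (ctrOff 4 Lc)) Lc m (blk Lc z) (β, x) (κ, (Lc : ℤ) • Y + toSite v - unitVec κ) (κ', u')
                + vh2KerAt (toSite (ctrOff 4 Lc)) Lc m (blk Lc z) (β, x) (κ', u') (κ, (Lc : ℤ) • Y + toSite v - unitVec κ)))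
              - (-((Lc : ℝ) ^ 12 / 4)) * ((1 / 2 : ℝ) * (vh2KerAt (toSite (ctrOff 4 Lc)) Lc m (blk Lc z) (β, x) (κ, (Lc : ℤ) • Y + toSite v) (κ', u')
                + vh2KerAt (toSite (ctrOff 4 Lc)) Lc m (blk Lc z) (β, x) (κ', u') (κ, (Lc : ℤ) • Y + toSite v)))) =
        (-((Lc : ℝ) ^ (3 + 1) * (1 / 2) * (Lc : ℝ) ^ (3 + 1))) * vhKerAt (toSite (ctrOff 4 Lc)) Lc m (blk Lc z) (β, x) (κ', u')
            * ((1 / 2 : ℝ) * ∑ v ∈ box (3 + 1) Lc, (if z + toSite (ctrOff 4 Lc) = (Lc : ℤ) • Y + toSite v then (1 : ℝ) else 0))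
          - ((1 / 2 : ℝ) * ∑ v ∈ box (3 + 1) Lc, (if x = (Lc : ℤ) • Y + toSite v then (1 : ℝ) else 0))
            * ((-((Lc : ℝ) ^ (3 + 1) * (1 / 2) * (Lc : ℝ) ^ (3 + 1))) * vhKerAt (toSite (ctrOff 4 Lc)) Lc m (blk Lc z) (β, x) (κ', u')))
    (hWM : ∀ (y : Fin (3 + 1) → ℤ) (ρ' : Fin (3 + 1)) (w : Fin (3 + 1) → ℤ) (β : Fin (3 + 1)) (x : Fin (3 + 1) → ℤ) (β' : Fin (3 + 1))
      (x' : Fin (3 + 1) → ℤ),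
      ((Lc : ℝ) ^ (3 + 1))⁻¹ * (∑ v ∈ box (3 + 1) Lc, ∑ κ : Fin (3 + 1),
          ((mixKerAt (toSite (ctrOff 4 Lc)) Lc ρ' w (κ, (Lc : ℤ) • y + toSite v - unitVec κ) (β, x) (β', x')
              - mixKerAt (toSite (ctrOff 4 Lc)) Lc ρ' w (κ, (Lc : ℤ) • y + toSite v) (β, x) (β', x'))
            + (mixKerAt (toSite (ctrOff 4 Lc)) Lc ρ' w (κ, (Lc : ℤ) • y + toSite v - unitVec κ) (β', x') (β, x)
              - mixKerAt (toSite (ctrOff 4 Lc)) Lc ρ' w (κ, (Lc : ℤ) • y + toSite v) (β', x') (β, x)))) =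
        2 * ((2 / (Lc : ℝ) ^ 4) * hessKerAt (toSite (ctrOff 4 Lc)) Lc ρ' w (β, x) (β', x') *
          ((1 / 2 : ℝ) * (∑ v ∈ box (3 + 1) Lc, (if x' = (Lc : ℤ) • y + toSite v then (1 : ℝ) else 0))
            - (1 / 2 : ℝ) * (∑ v ∈ box (3 + 1) Lc, (if x = (Lc : ℤ) • y + toSite v then (1 : ℝ) else 0)))))
    -- the route theorem's own binders (printed B5 facts, channel, colour parameter, window), verbatim from K-Q
    (a : ℝ) (ha : 0 < a)
    (h12 : B5.Prop12Printed (fam (fun i : ℕ+ × ℕ => ((i.1 : ℕ+) : ℕ)) (fun i => i.1.pos) MvE a ha))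
    (h126 : B5.Kernel126_127Printed (kfam (fun i : ℕ+ × ℕ => ((i.1 : ℕ+) : ℕ)) MvE))
    {L : Type*} {SL : Finset L} (hSL : SL.Nonempty) (k : L → Fin 4) {μ ν : Fin 4} (hμν : μ ≠ ν) {Nc : ℝ} (hNc : Nc ≠ 0)
    (Jc : ∀ m : ℕ, JetData 3 (Lc ^ m)) (htel : D1Tel Lc (JsRowD1Pin hLc N) Jc)
    {cc : ℝ} {M : ℕ → ℕ} (hc : 1 ≤ cc) (hMw : ∀ L : ℕ, 2 ≤ L → 1 ≤ M L ∧ (L : ℝ) ≤ cc * M L) (hML : ∀ L : ℕ, 2 ≤ L → M L ≤ L)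
    (hrep : D1Rep Lc Jc Nc μ ν a SL k) :
    D1Drift Lc (JsRowD1Pin hLc N) Nc μ ν := by
  obtain ⟨hW, hR⟩ := symmetries_JsRowD1Pin_of_bondLaws hLc hN γ hγ hMb hBb hWb hWM
  exact d1Drift_of_D1Tel_D1Rep a ha h12 h126 hSL k hμν hNc hL2 (JsRowD1Pin hLc N) Jc hW hR htel hc hMw hML hrep

end

end Summit.QuantumFields.BalabanUV.Beta.RowD1FromBondLaws
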